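/-
Copyright (c) 2026. All rights reserved.
Released under Apache 2.0 license as described in the file LICENSE.
Authors: abc-iut cell, seat abc-iut-w5-d226 (gen 3; consumer of GAP G-w5d226-2 «G-P13-GR», L4-lead RULING
#5i (3) «constructing the DPSCData of a pointed stable curve from the L3 datum» / offer (α)+(β)).
-/
import Literature.AnabelianGeometry.AbsoluteAnabelian.AbsTopII.DPSCDataOfSemiGraphGraphic
import Literature.AnabelianGeometry.AbsoluteAnabelian.AbsTopII.DPSCDataOfSemiGraphSlim
import Literature.AnabelianGeometry.SemiGraphs.PSCMapAlongEquivTransfer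
import Literature.AnabelianGeometry.SemiGraphs.PSCCoveringMapAlongTransfer
import Mathlib.Topology.Algebra.Category.ProfiniteGrp.Basic
import HarnessLib

/-!
# [AbsTopII] Def 1.2 (ii): the DPSC data of a PSC datum EMBEDDED in a profinite extension, and Prop 1.3

S. Mochizuki, *Topics in Absolute Anabelian Geometry II* [AbsTopII] (bib `MochizukiAbsTopII2013`; kurims
manuscript `paper:url-585b8d0ad0d9`), §1 Def 1.2 (ii) p. 10: a DPSC-extension is an extension of profinite
groups `1 → Π_𝒢 → Π_H → H → 1` (isomorphic to `Π_𝒢 ⋊^out H`), with its inertia part `Π_I ⊇ Π_𝒢`; "each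
vertex `v` (respectively, edge `e`) of `𝒢` determines [up to conjugation in `Π_𝒢`] a subgroup
`Π_v ⊆ Π_𝒢` (respectively, `Π_e ⊆ Π_𝒢`)", and `D_v, I_v, D_e, I_e` are DEFINED from these.  [CombGC]
(bib `MochizukiCombGC2007`) Def 1.1 (ii) pp. 6–7: the PSC-fundamental group `Π_𝒢` with its verticial /
edge-like subgroups = layer L3's `SemiGraphs.PSCDatum`.

ONE DEFINITION: `DPSCData.ofEmbedding G E ι … PiI …` — the abc-iut-L4 `DPSCData` ([AbsTopII] Prop 1.3
typing, abc-iut-L4-t4) whose `Π_H` is a given profinite group `E`, whose `Π_𝔾` is the (closed, normal)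
range of a continuous injective homomorphism `ι : Π_𝒢 → E` from the carrier of an L3 PSC datum `G`, whose
`Π_I` is a given normal subgroup between them, and whose vertices / nodes / cusps and `Π_v, Π_e` are THOSE
OF `G`, pushed along `ι`.  With `E := Π_𝒢 ⋊^out H` (GAP G-w5d226-2: abc-iut-w5-d151's
`outerSemidirectProfinite` / abc-iut-L3-d5's `outerSemidirectProduct.exists_profinite_topology`, p432948 ✓)
this IS the printed DPSC-extension of the construction data; the definition is kept extension-agnostic so
that every such carrier (and a future geometric `π₁`) is served by name.

THEOREMS (proof that the three abc-iut-L4 bridge files `AbsTopII/DPSCDataOfSemiGraph{,Graphic,Slim}.lean`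
apply, with the presentation `G.mapAlong (Π_𝒢 ≃ₜ* Π_𝔾)` and `δ = 1`, and the L3 transport lemmas
`SemiGraphs/PSCMapAlongEquivTransfer.lean`):

* `prop13vi_ofEmbedding` — **[AbsTopII] Prop 1.3 (vi) AS TYPED (F-0279) for the embedded datum from:
  (1) graphicity of the conjugation action of `E` on `Π_𝒢` ([CombGC] Def 1.4 (i); for `E = Π_𝒢 ⋊^out H` =
  "`ρ_H : H → Aut(𝒢) ⊆ Out(Π_𝒢)`"), (2) [CombGC] Prop 1.2 (ii) for `G`, (3) [CombGC] Prop 1.2 (i) for `G`**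
  — nothing else;
* `prop13vii_ofEmbedding` (F-0280; + the Prop 1.3 (ii) clauses), `prop13v_ofEmbedding` (F-0278; + "(iv)
  at open subgroups", `I_v` infinite), `prop13ix_ofEmbedding` (F-0277; + `Π_𝒢` slim nontrivial, `Π_e ≤ I_e`,
  `Π_e` abelian for cusps), `prop13iii_ofEmbedding` (F-0275; + `Π_v` slim, `I_v ↠ I`).

HONEST FRAMING: a construction + classical group theory over two typed interfaces; the inputs that remain
are NAMED ([CombGC] Prop 1.2 (i)(ii) = printed facts F-0459/F-0438 at PSC-type data; Rmk 1.1.3 slimness;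
the Prop 1.3 (i)(ii)(iii)(iv) log-structure clauses); typed ≠ proved; nothing here bears on [IUTchIII]
Cor 3.12 or takes a side on any author.
-/

noncomputable section

open scoped Pointwise

namespace Literature.AnabelianGeometry.AbsoluteAnabelian

open Literature.AlgebraicGeometry.Frobenioids (IsSlimGroup)
open Literature.AnabelianGeometry.SemiGraphs
open Topology

universe u

namespace DPSCData

section Embedding

variable {P : Type u} [Group P] [TopologicalSpace P]
  (G : PSCDatum P) (E : ProfiniteGrp.{u}) (ι : P →* E)
  (hιr : IsClosed (ι.range : Set E)) (hιn : ι.range.Normal)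
  (PiI : Subgroup E) (hIn : PiI.Normal) (hle : ι.range ≤ PiI)

/-- **[AbsTopII] Def 1.2 (ii): the DPSC data of a PSC datum embedded in a profinite extension.**
`Π_H := E`, `Π_𝔾 := ι(Π_𝒢)` (closed, normal), `Π_I := PiI`; vertices / nodes / cusps of the underlying
semi-graph of `G` (lifted to universe `u`); `Π_v := ι(Π_{G,v})`, `Π_e := ι(Π_{G,e})`; a node `e` abuts to
`v` iff `v` is an end of `e`, a cusp abuts to its vertex.  For `E = Π_𝒢 ⋊^out H` this is "the DPSC-extension
associated to the construction data" (p. 10). [cite: MochizukiAbsTopII2013, Def 1.2 (ii) p.10] -/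
def ofEmbedding : DPSCData.{u} where
  PiH := E
  PiG := ι.range
  normal_PiG := hιn
  isClosed_PiG := hιr
  PiI := PiI
  PiG_le_PiI := hle
  normal_PiI := hIn
  Vert := ULift.{u} G.graph.V
  Node := ULift.{u} G.graph.N
  Cusp := ULift.{u} G.graph.C
  vertSub v := (G.vertGp v.down).map ι
  vertSub_le _ := Subgroup.map_le_range _ _
  nodeSub e := (G.nodeGp e.down).map ι
  nodeSub_le _ := Subgroup.map_le_range _ _
  cuspSub c := (G.cuspGp c.down).map ι
  cuspSub_le _ := Subgroup.map_le_range _ _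
  nodeAbuts e v := v.down ∈ G.graph.nodeEnds e.down
  cuspVert c := ⟨G.graph.cuspEnd c.down⟩

/-- `Π_H` of the embedded datum is `E`. [cite: MochizukiAbsTopII2013, Def 1.2 (ii) p.10] -/
@[simp] theorem ofEmbedding_PiH : (ofEmbedding G E ι hιr hιn PiI hIn hle).PiH = E := rfl

/-- `Π_𝔾` of the embedded datum is `ι(Π_𝒢)`. [cite: MochizukiAbsTopII2013, Def 1.2 (ii) p.10] -/
@[simp] theorem ofEmbedding_PiG : (ofEmbedding G E ι hιr hιn PiI hIn hle).PiG = ι.range := rfl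

/-- `Π_I` of the embedded datum. [cite: MochizukiAbsTopII2013, Def 1.2 (ii) p.10] -/
@[simp] theorem ofEmbedding_PiI : (ofEmbedding G E ι hιr hιn PiI hIn hle).PiI = PiI := rfl

/-- `Π_v` of the embedded datum is `ι(Π_{G,v})`. [cite: MochizukiAbsTopII2013, Def 1.2 (ii) p.10] -/
@[simp] theorem ofEmbedding_vertSub (v : ULift.{u} G.graph.V) :
    (ofEmbedding G E ι hιr hιn PiI hIn hle).vertSub v = (G.vertGp v.down).map ι := rfl

/-- `Π_e` (node) of the embedded datum is `ι(Π_{G,e})`. [cite: MochizukiAbsTopII2013, Def 1.2 (ii) p.10] -/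
@[simp] theorem ofEmbedding_nodeSub (n : ULift.{u} G.graph.N) :
    (ofEmbedding G E ι hιr hιn PiI hIn hle).nodeSub n = (G.nodeGp n.down).map ι := rfl

/-- `Π_e` (cusp) of the embedded datum is `ι(Π_{G,e})`. [cite: MochizukiAbsTopII2013, Def 1.2 (ii) p.10] -/
@[simp] theorem ofEmbedding_cuspSub (c : ULift.{u} G.graph.C) :
    (ofEmbedding G E ι hιr hιn PiI hIn hle).cuspSub c = (G.cuspGp c.down).map ι := rfl

end Embedding

/-! ### The embedding as an isomorphism of topological groups `Π_𝒢 ≃ₜ* Π_𝔾`; the presentation -/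

section Presentation

variable {P : Type u} [Group P] [TopologicalSpace P] [CompactSpace P]
  (G : PSCDatum P) (E : ProfiniteGrp.{u}) (ι : P →* E)
  (hιr : IsClosed (ι.range : Set E)) (hιn : ι.range.Normal)
  (PiI : Subgroup E) (hIn : PiI.Normal) (hle : ι.range ≤ PiI)

/-- A continuous injective homomorphism from a compact group into a Hausdorff group is an isomorphism of
topological groups onto its range: `Π_𝒢 ≃ₜ* Π_𝔾`. [cite: MochizukiAbsTopII2013, Def 1.2 (ii) p.10] -/
theorem exists_rangeEquiv (hιc : Continuous ι) (hιi : Function.Injective ι) :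
    ∃ e : P ≃ₜ* ↥(ofEmbedding G E ι hιr hιn PiI hIn hle).PiG, ∀ x : P, ((e x : ↥(ofEmbedding G E ι hιr hιn PiI hIn hle).PiG) : (ofEmbedding G E ι hιr hιn PiI hIn hle).PiH) = ι x := by
  let f : P ≃ ↥ι.range := Equiv.ofBijective ι.rangeRestrict
    ⟨fun x y h => hιi (by simpa using congrArg Subtype.val h), ι.rangeRestrict_surjective⟩
  have hf : Continuous f := hιc.subtype_mk _
  let h : P ≃ₜ ↥ι.range := hf.homeoOfEquivCompactToT2
  exact ⟨{ ι.rangeRestrict with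
      toFun := f, invFun := f.symm, left_inv := f.left_inv, right_inv := f.right_inv,
      continuous_toFun := hf, continuous_invFun := h.continuous_symm }, fun x => rfl⟩

omit [CompactSpace P] in
/-- Reading `ι(K)` inside `Π_𝔾 = ι(Π_𝒢)` through a range isomorphism.
[cite: MochizukiAbsTopII2013, Def 1.2 (ii) p.10] -/
theorem subgroupOf_range_map_eq {e : P ≃ₜ* ↥(ofEmbedding G E ι hιr hιn PiI hIn hle).PiG}
    (he : ∀ x : P, ((e x : ↥(ofEmbedding G E ι hιr hιn PiI hIn hle).PiG) : (ofEmbedding G E ι hιr hιn PiI hIn hle).PiH) = ι x) (K : Subgroup P) :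
    (K.map ι).subgroupOf (ofEmbedding G E ι hιr hιn PiI hIn hle).PiG = K.map e.toMulEquiv.toMonoidHom := by
  ext y
  simp only [Subgroup.mem_subgroupOf, Subgroup.mem_map]
  constructor
  · rintro ⟨x, hx, hxy⟩
    refine ⟨x, hx, Subtype.ext ?_⟩
    rw [← he x] at hxy
    exact hxy
  · rintro ⟨x, hx, rfl⟩
    exact ⟨x, hx, (he x).symm⟩

omit [CompactSpace P] in
/-- Slimness along the restriction of an isomorphism of topological groups to a subgroup.
[cite: MochizukiCombGC2007, Rmk 1.1.3 p.8] -/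
theorem isSlimGroup_map_continuousMulEquiv {Q : Type u} [Group Q] [TopologicalSpace Q] (e : P ≃ₜ* Q)
    {K : Subgroup P} (hK : IsSlimGroup ↥K) : IsSlimGroup ↥(K.map e.toMulEquiv.toMonoidHom) := by
  have hmem : ∀ x : P, x ∈ K → e x ∈ K.map e.toMulEquiv.toMonoidHom := fun x hx =>
    Subgroup.mem_map_of_mem _ hx
  have hmem' : ∀ y : Q, y ∈ K.map e.toMulEquiv.toMonoidHom → e.symm y ∈ K := by
    rintro y ⟨x, hx, rfl⟩
    change e.symm (e x) ∈ K
    rw [e.symm_apply_apply]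
    exact hx
  let f : ↥K ≃ₜ* ↥(K.map e.toMulEquiv.toMonoidHom) :=
    { toFun := fun x => ⟨e x, hmem x x.2⟩
      invFun := fun y => ⟨e.symm y, hmem' y y.2⟩
      left_inv := fun x => by ext; simp
      right_inv := fun y => by ext; simp
      map_mul' := fun x y => by
        apply Subtype.ext
        change e ((x : P) * y) = e x * e y
        exact map_mul e _ _
      continuous_toFun := (e.continuous.comp continuous_subtype_val).subtype_mk _
      continuous_invFun := (e.symm.continuous.comp continuous_subtype_val).subtype_mk _ }
  exact isSlimGroup_of_continuousMulEquiv f hK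

/-- **Presentation (vertices)**: `Π_v` of the embedded datum, read inside `Π_𝔾`, IS the verticial
representative of `G.mapAlong (Π_𝒢 ≃ₜ* Π_𝔾)` (`δ = 1`). [cite: MochizukiCombGC2007, Def 1.1(ii) p.6] -/
theorem vertSub_presentation {e : P ≃ₜ* ↥(ofEmbedding G E ι hιr hιn PiI hIn hle).PiG}
    (he : ∀ x : P, ((e x : ↥(ofEmbedding G E ι hιr hιn PiI hIn hle).PiG) : (ofEmbedding G E ι hιr hιn PiI hIn hle).PiH) = ι x)
    (v : (ofEmbedding G E ι hιr hιn PiI hIn hle).Vert) :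
    ∃ δ : ConjAct ↥(ofEmbedding G E ι hιr hιn PiI hIn hle).PiG, ((ofEmbedding G E ι hιr hιn PiI hIn hle).vertSub v).subgroupOf (ofEmbedding G E ι hιr hιn PiI hIn hle).PiG =
      δ • (G.mapAlong e.toMulEquiv.toMonoidHom e.continuous G.Sigma subset_rfl G.sigma_nonempty
        (G.proSigma.of_continuousMulEquiv e)).vertGp (Equiv.ulift v) :=
  ⟨1, by rw [one_smul, PSCDatum.mapAlong_vertGp]; exact subgroupOf_range_map_eq G E ι hιr hιn PiI hIn hle he _⟩

/-- **Presentation (nodes)**, `δ = 1`. [cite: MochizukiCombGC2007, Def 1.1(ii) p.7] -/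
theorem nodeSub_presentation {e : P ≃ₜ* ↥(ofEmbedding G E ι hιr hιn PiI hIn hle).PiG}
    (he : ∀ x : P, ((e x : ↥(ofEmbedding G E ι hιr hιn PiI hIn hle).PiG) : (ofEmbedding G E ι hιr hιn PiI hIn hle).PiH) = ι x)
    (n : (ofEmbedding G E ι hιr hιn PiI hIn hle).Node) :
    ∃ δ : ConjAct ↥(ofEmbedding G E ι hιr hιn PiI hIn hle).PiG, ((ofEmbedding G E ι hιr hιn PiI hIn hle).nodeSub n).subgroupOf (ofEmbedding G E ι hιr hιn PiI hIn hle).PiG =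
      δ • (G.mapAlong e.toMulEquiv.toMonoidHom e.continuous G.Sigma subset_rfl G.sigma_nonempty
        (G.proSigma.of_continuousMulEquiv e)).nodeGp (Equiv.ulift n) :=
  ⟨1, by rw [one_smul, PSCDatum.mapAlong_nodeGp]; exact subgroupOf_range_map_eq G E ι hιr hιn PiI hIn hle he _⟩

/-- **Presentation (cusps)**, `δ = 1`. [cite: MochizukiCombGC2007, Def 1.1(ii) p.7] -/
theorem cuspSub_presentation {e : P ≃ₜ* ↥(ofEmbedding G E ι hιr hιn PiI hIn hle).PiG}
    (he : ∀ x : P, ((e x : ↥(ofEmbedding G E ι hιr hιn PiI hIn hle).PiG) : (ofEmbedding G E ι hιr hιn PiI hIn hle).PiH) = ι x)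
    (c : (ofEmbedding G E ι hιr hιn PiI hIn hle).Cusp) :
    ∃ δ : ConjAct ↥(ofEmbedding G E ι hιr hιn PiI hIn hle).PiG, ((ofEmbedding G E ι hιr hιn PiI hIn hle).cuspSub c).subgroupOf (ofEmbedding G E ι hιr hιn PiI hIn hle).PiG =
      δ • (G.mapAlong e.toMulEquiv.toMonoidHom e.continuous G.Sigma subset_rfl G.sigma_nonempty
        (G.proSigma.of_continuousMulEquiv e)).cuspGp (Equiv.ulift c) :=
  ⟨1, by rw [one_smul, PSCDatum.mapAlong_cuspGp]; exact subgroupOf_range_map_eq G E ι hιr hιn PiI hIn hle he _⟩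

/-- **Presentation (graphicity)**: if conjugation by every element of `E` restricts on `Π_𝒢` to a GRAPHIC
automorphism ([CombGC] Def 1.4 (i); [AbsTopII] Def 1.2 (ii) "`ρ_H : H → Aut(𝒢) ⊆ Out(Π_𝒢)`"), then the
bridge's hypothesis `hgr` holds for the embedded datum presented by `G.mapAlong (Π_𝒢 ≃ₜ* Π_𝔾)`.
[cite: MochizukiAbsTopII2013, Def 1.2 (ii) p.10] [cite: MochizukiCombGC2007, Def 1.4(i) p.10] -/
theorem graphic_presentation {e : P ≃ₜ* ↥(ofEmbedding G E ι hιr hιn PiI hIn hle).PiG}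
    (he : ∀ x : P, ((e x : ↥(ofEmbedding G E ι hιr hιn PiI hIn hle).PiG) : (ofEmbedding G E ι hιr hιn PiI hIn hle).PiH) = ι x)
    (hconj : ∀ h : E, ∃ φ : P ≃ₜ* P, (∀ x, h * ι x * h⁻¹ = ι (φ x)) ∧ G.IsGraphic G φ)
    (h : (ofEmbedding G E ι hιr hιn PiI hIn hle).PiH) :
    ∃ α : ↥(ofEmbedding G E ι hιr hιn PiI hIn hle).PiG ≃ₜ* ↥(ofEmbedding G E ι hιr hιn PiI hIn hle).PiG,
      (∀ x, ((α x : ↥(ofEmbedding G E ι hιr hιn PiI hIn hle).PiG) : (ofEmbedding G E ι hιr hιn PiI hIn hle).PiH) = h * x * h⁻¹) ∧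
        (G.mapAlong e.toMulEquiv.toMonoidHom e.continuous G.Sigma subset_rfl G.sigma_nonempty
        (G.proSigma.of_continuousMulEquiv e)).IsGraphic
          (G.mapAlong e.toMulEquiv.toMonoidHom e.continuous G.Sigma subset_rfl G.sigma_nonempty
        (G.proSigma.of_continuousMulEquiv e)) α := by
  obtain ⟨φ, hφ, hgraphic⟩ := hconj h
  refine ⟨(e.symm.trans φ).trans e, fun y => ?_, ?_⟩
  · change (((e (φ (e.symm y))) : ↥(ofEmbedding G E ι hιr hιn PiI hIn hle).PiG) : (ofEmbedding G E ι hιr hιn PiI hIn hle).PiH) = h * (y : (ofEmbedding G E ι hιr hιn PiI hIn hle).PiH) * h⁻¹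
    have hy : ((y : ↥(ofEmbedding G E ι hιr hιn PiI hIn hle).PiG) : (ofEmbedding G E ι hιr hιn PiI hIn hle).PiH) = ι (e.symm y) := by
      have := he (e.symm y)
      rwa [e.apply_symm_apply] at this
    rw [he, hy]
    exact (hφ _).symm
  · refine PSCDatum.IsGraphic.mapAlong G G e.toMulEquiv.toMonoidHom e.continuous G.Sigma subset_rfl
      G.sigma_nonempty (G.proSigma.of_continuousMulEquiv e) e.toMulEquiv.toMonoidHom e.continuous
      subset_rfl (G.proSigma.of_continuousMulEquiv e) hgraphic (fun x => ?_)
    change e (φ (e.symm (e x))) = e (φ x)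
    rw [e.symm_apply_apply]

end Presentation

/-! ### [AbsTopII] Prop 1.3 for the embedded datum -/

section Prop13

variable {P : Type u} [Group P] [TopologicalSpace P] [CompactSpace P]
  (G : PSCDatum P) (E : ProfiniteGrp.{u}) (ι : P →* E) (hιc : Continuous ι)
  (hιi : Function.Injective ι) (hιr : IsClosed (ι.range : Set E)) (hιn : ι.range.Normal)
  (PiI : Subgroup E) (hIn : PiI.Normal) (hle : ι.range ≤ PiI)

include hιc hιi

/-- **[AbsTopII] Prop 1.3 (vi) AS TYPED (F-0279) for the embedded datum** from (1) graphicity of the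
conjugation action of `E` on `Π_𝒢` ([CombGC] Def 1.4 (i); = "`ρ_H : H → Aut(𝒢) ⊆ Out(Π_𝒢)`" for
`E = Π_𝒢 ⋊^out H`), (2) [CombGC] Prop 1.2 (ii) for `G`, (3) [CombGC] Prop 1.2 (i) for `G` — both halves
("the image of `D_v` in `H` is open"; "`D_v` is not open in `Π_H`").
[cite: MochizukiAbsTopII2013, Prop 1.3 (vi) p.12] [cite: MochizukiCombGC2007, Prop 1.2 p.8] -/
theorem prop13vi_ofEmbedding
    (hconj : ∀ h : E, ∃ φ : P ≃ₜ* P, (∀ x, h * ι x * h⁻¹ = ι (φ x)) ∧ G.IsGraphic G φ)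
    (hCT : G.VerticialEdgeLikeCommensurablyTerminal) (hDetV : G.VerticialOpenInterDeterminesVertex) :
    (ofEmbedding G E ι hιr hιn PiI hIn hle).Prop13vi := by
  obtain ⟨e, he⟩ := exists_rangeEquiv G E ι hιr hιn PiI hIn hle hιc hιi
  exact prop13vi_of_psc (ofEmbedding G E ι hιr hιn PiI hIn hle)
    (G.mapAlong e.toMulEquiv.toMonoidHom e.continuous G.Sigma subset_rfl G.sigma_nonempty
        (G.proSigma.of_continuousMulEquiv e))
    Equiv.ulift (vertSub_presentation G E ι hιr hιn PiI hIn hle he)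
    ((PSCDatum.verticialEdgeLikeCommensurablyTerminal_mapAlong_equiv_iff G e _ _ _ _).mpr hCT)
    ((PSCDatum.verticialOpenInterDeterminesVertex_mapAlong_equiv_iff G e _ _ _ _).mpr hDetV)
    (graphic_presentation G E ι hιr hιn PiI hIn hle he hconj)

/-- **[AbsTopII] Prop 1.3 (vii) AS TYPED (F-0280) for the embedded datum** from graphicity, [CombGC]
Prop 1.2 (i)(ii) for `G`, and the Prop 1.3 (ii) clauses `Π_e ≤ I_e`, `I_e·Π_𝔾 = Π_I` (`hii`, geometric).
[cite: MochizukiAbsTopII2013, Prop 1.3 (vii) p.12] [cite: MochizukiCombGC2007, Prop 1.2 p.8] -/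
theorem prop13vii_ofEmbedding
    (hconj : ∀ h : E, ∃ φ : P ≃ₜ* P, (∀ x, h * ι x * h⁻¹ = ι (φ x)) ∧ G.IsGraphic G φ)
    (hCT : G.VerticialEdgeLikeCommensurablyTerminal) (hDet : G.EdgeLikeOpenInterDeterminesEdge)
    (hii : ∀ n, (ofEmbedding G E ι hιr hιn PiI hIn hle).nodeSub n ≤ (ofEmbedding G E ι hιr hιn PiI hIn hle).IvNode n ∧
      (ofEmbedding G E ι hιr hιn PiI hIn hle).IvNode n ⊔ (ofEmbedding G E ι hιr hιn PiI hIn hle).PiG = (ofEmbedding G E ι hιr hιn PiI hIn hle).PiI) :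
    (ofEmbedding G E ι hιr hιn PiI hIn hle).Prop13vii := by
  obtain ⟨e, he⟩ := exists_rangeEquiv G E ι hιr hιn PiI hIn hle hιc hιi
  exact prop13vii_of_psc (ofEmbedding G E ι hιr hιn PiI hIn hle)
    (G.mapAlong e.toMulEquiv.toMonoidHom e.continuous G.Sigma subset_rfl G.sigma_nonempty
        (G.proSigma.of_continuousMulEquiv e))
    Equiv.ulift Equiv.ulift (nodeSub_presentation G E ι hιr hιn PiI hIn hle he)
    (cuspSub_presentation G E ι hιr hιn PiI hIn hle he)
    ((PSCDatum.verticialEdgeLikeCommensurablyTerminal_mapAlong_equiv_iff G e _ _ _ _).mpr hCT)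
    ((PSCDatum.edgeLikeOpenInterDeterminesEdge_mapAlong_equiv_iff G e _ _ _ _).mpr hDet)
    (graphic_presentation G E ι hιr hιn PiI hIn hle he hconj) hii

/-- **[AbsTopII] Prop 1.3 (v) (outer clauses) AS TYPED (F-0278) for the embedded datum** from graphicity,
[CombGC] Prop 1.2 (i)(ii) for `G`, "(iv) at open subgroups" (`hL`) and "`I_v` infinite" (`hinf`).
[cite: MochizukiAbsTopII2013, Prop 1.3 (v) p.12] [cite: MochizukiCombGC2007, Prop 1.2 p.8] -/
theorem prop13v_ofEmbedding
    (hconj : ∀ h : E, ∃ φ : P ≃ₜ* P, (∀ x, h * ι x * h⁻¹ = ι (φ x)) ∧ G.IsGraphic G φ)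
    (hCT : G.VerticialEdgeLikeCommensurablyTerminal) (hDetV : G.VerticialOpenInterDeterminesVertex)
    (hL : ∀ (v : (ofEmbedding G E ι hιr hιn PiI hIn hle).Vert) (g : (ofEmbedding G E ι hιr hιn PiI hIn hle).PiH),
      (ofEmbedding G E ι hιr hιn PiI hIn hle).Iv v ⊓ MulAut.conj g • (ofEmbedding G E ι hιr hιn PiI hIn hle).Iv v ≠ ⊥ →
        MulAut.conj g • (ofEmbedding G E ι hιr hιn PiI hIn hle).vertSub v = (ofEmbedding G E ι hιr hιn PiI hIn hle).vertSub v)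
    (hinf : ∀ v, Infinite ↥((ofEmbedding G E ι hιr hιn PiI hIn hle).Iv v)) :
    (ofEmbedding G E ι hιr hιn PiI hIn hle).Prop13v := by
  obtain ⟨e, he⟩ := exists_rangeEquiv G E ι hιr hιn PiI hIn hle hιc hιi
  exact prop13v_of_psc (ofEmbedding G E ι hιr hιn PiI hIn hle)
    (G.mapAlong e.toMulEquiv.toMonoidHom e.continuous G.Sigma subset_rfl G.sigma_nonempty
        (G.proSigma.of_continuousMulEquiv e))
    Equiv.ulift (vertSub_presentation G E ι hιr hιn PiI hIn hle he)
    ((PSCDatum.verticialEdgeLikeCommensurablyTerminal_mapAlong_equiv_iff G e _ _ _ _).mpr hCT)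
    ((PSCDatum.verticialOpenInterDeterminesVertex_mapAlong_equiv_iff G e _ _ _ _).mpr hDetV)
    (graphic_presentation G E ι hιr hιn PiI hIn hle he hconj) hL hinf

/-- **[AbsTopII] Prop 1.3 (ix) AS TYPED (F-0277) for the embedded datum** from graphicity, [CombGC]
Prop 1.2 (ii) for `G`, `Π_𝒢` slim nontrivial ([CombGC] Rmk 1.1.3 — named), `Π_e ≤ I_e` (Prop 1.3 (ii))
and "`Π_e` abelian" for cusps (Prop 1.3 (i)).
[cite: MochizukiAbsTopII2013, Prop 1.3 (ix) p.12] [cite: MochizukiCombGC2007, Prop 1.2 p.8] -/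
theorem prop13ix_ofEmbedding [Nontrivial P] (hslim : IsSlimGroup P)
    (hconj : ∀ h : E, ∃ φ : P ≃ₜ* P, (∀ x, h * ι x * h⁻¹ = ι (φ x)) ∧ G.IsGraphic G φ)
    (hCT : G.VerticialEdgeLikeCommensurablyTerminal)
    (hii : ∀ n, (ofEmbedding G E ι hιr hιn PiI hIn hle).nodeSub n ≤ (ofEmbedding G E ι hιr hιn PiI hIn hle).IvNode n)
    (hab : ∀ c, ∀ x ∈ (ofEmbedding G E ι hιr hιn PiI hIn hle).cuspSub c, ∀ y ∈ (ofEmbedding G E ι hιr hιn PiI hIn hle).cuspSub c, x * y = y * x) :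
    (ofEmbedding G E ι hιr hιn PiI hIn hle).Prop13ix := by
  obtain ⟨e, he⟩ := exists_rangeEquiv G E ι hιr hιn PiI hIn hle hιc hιi
  haveI : Nontrivial ↥(ofEmbedding G E ι hιr hιn PiI hIn hle).PiG := e.toEquiv.symm.nontrivial
  exact prop13ix_of_psc (ofEmbedding G E ι hιr hιn PiI hIn hle)
    (G.mapAlong e.toMulEquiv.toMonoidHom e.continuous G.Sigma subset_rfl G.sigma_nonempty
        (G.proSigma.of_continuousMulEquiv e))
    Equiv.ulift Equiv.ulift (isSlimGroup_of_continuousMulEquiv e hslim)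
    (nodeSub_presentation G E ι hιr hιn PiI hIn hle he) (cuspSub_presentation G E ι hιr hιn PiI hIn hle he)
    ((PSCDatum.verticialEdgeLikeCommensurablyTerminal_mapAlong_equiv_iff G e _ _ _ _).mpr hCT)
    (graphic_presentation G E ι hιr hιn PiI hIn hle he hconj) hii hab

/-- **[AbsTopII] Prop 1.3 (iii), first clauses, AS TYPED (F-0275) for the embedded datum** from [CombGC]
Prop 1.2 (ii) for `G`, slimness of `G`'s verticial subgroups ([CombGC] Rmk 1.1.3 — named) and
"`I_v ↠ I`" (`hsurj`, the log-structure input of p. 13); graphicity is not needed here.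
[cite: MochizukiAbsTopII2013, Prop 1.3 (iii) p.11] [cite: MochizukiCombGC2007, Prop 1.2 p.8] -/
theorem prop13iii_ofEmbedding
    (hCT : G.VerticialEdgeLikeCommensurablyTerminal) (hslimv : ∀ w, IsSlimGroup ↥(G.vertGp w))
    (hsurj : ∀ v, (ofEmbedding G E ι hιr hιn PiI hIn hle).Iv v ⊔ (ofEmbedding G E ι hιr hιn PiI hIn hle).PiG = (ofEmbedding G E ι hιr hιn PiI hIn hle).PiI) :
    (ofEmbedding G E ι hιr hιn PiI hIn hle).Prop13iii := by
  obtain ⟨e, he⟩ := exists_rangeEquiv G E ι hιr hιn PiI hIn hle hιc hιi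
  have hslim' : ∀ w, IsSlimGroup
      ↥((G.mapAlong e.toMulEquiv.toMonoidHom e.continuous G.Sigma subset_rfl G.sigma_nonempty
        (G.proSigma.of_continuousMulEquiv e)).vertGp w) := fun w => by
    rw [PSCDatum.mapAlong_vertGp]
    exact isSlimGroup_map_continuousMulEquiv e (hslimv w)
  exact prop13iii_of_psc' (ofEmbedding G E ι hιr hιn PiI hIn hle)
    (G.mapAlong e.toMulEquiv.toMonoidHom e.continuous G.Sigma subset_rfl G.sigma_nonempty
        (G.proSigma.of_continuousMulEquiv e))
    Equiv.ulift (vertSub_presentation G E ι hιr hιn PiI hIn hle he)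
    ((PSCDatum.verticialEdgeLikeCommensurablyTerminal_mapAlong_equiv_iff G e _ _ _ _).mpr hCT)
    hslim' hsurj

end Prop13

end DPSCData

end Literature.AnabelianGeometry.AbsoluteAnabelian

end
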